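/-
COR-CM (cell pub-hodgecm2, stage 2 of the Hodge ladder) — count-neutral KERNEL CENSUS → TREE TRANSPORT of the faithful full odd
slice (seat prover-pub-hodgecm2-b23-g36-0, binder prover b23, gen 36; claim ODD-SLICE-TRANSPORT F3, HOME/INBOX.md
2026-08-22T05:31:42Z; sequel of `CorCM/FaceCensusOddSliceClosed.lean`).  Theorems only: seat b09's generation theorem for the
faithful full slice of `(ℤ/2 × A, (1,0))`, `|A|` odd (`Census/OddSliceFacesGenerate.lean` `hodge_le_pairs_sup_spanFaces_family`,
`family_places`; `Census/OddSliceFacesCount.lean` `family_card`) and seat b17's orbit counts (`Census/OddDegreeParityLawRelative.lean`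
`card_orbitsA_zmod_nine` / `_fifteen` / `_three_sq`, `Census/OddDegreeParityLawCyclicPrime.lean` `card_orbits_eq`) are consumed BY
NAME through the odd-slice transport; nothing of theirs is restated or re-filed; no definition, no named fact, nothing asserted;
`Interfaces.lean` (C1), every E term, B01 and `Transposition/*` are untouched.
HONEST FRAMING (COORDINATOR RULING — HODGE FRAMING CORRECTION, 2026-08-21T11:55:35Z): `HC_CM` is NOT proved, here or anywhere in
the tree.  Every theorem below says, for ONE Galois CM field `K`: a finite set of at most `N` rank-four faces of `K` EXISTS whose
face periods on the universe of record would imply the Hodge conjecture for the abelian varieties generated by `K`; no period is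
produced and nothing is discharged for any field.
T5 (coordinator ruling 15:33:56Z (3)): binder sets = {dictionary datum (transport of structure / `Aut(K)` / a generator), `|A|` odd
`≥ 3`, face periods on the produced set = instances of the crux (`FacePeriodExists` / B01-S) with no `¬` theorem in the tree on the
universe of record} — no contradiction derivable; checker: self (prover-pub-hodgecm2-b23-g36-0), 2026-08-22.
-/
import Summits.HodgeConjecture.CorCM.FaceCensusOddSliceClosed
import Summits.HodgeConjecture.CorCM.Census.OddSliceFacesCount
import HarnessLib

/-!
# The faithful full odd slice, transported: `#OrbitsA A` face periods per field suffice (degrees `≡ 2 (mod 4)`, abelian group)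

(NOT a twin of `CorCM/FaceCensusOddSliceTransport.lean`: that file is the GENERIC transport — any generating label family `S` of
b09's model ⟹ `hgen` —; this file is its INSTANTIATION with b09's generating family `family A` and b17's orbit counts.)

Seat b09's theorem (`Census/OddSliceFacesGenerate.lean`): for every finite abelian group `A` of odd order `≥ 3`, the Hodge lattice
of the representative-free model of the faithful full slice of `(ℤ/2 × A, (1,0))` is generated, together with the divisor pairs, by
the Galois translates of the classes of a family `family A` of rank-four label faces with `|family A| = #OrbitsA A` = the number of
isogeny classes of simple CM abelian varieties other than `E` split by the field (seat b17's `oddSlice_law` says no smaller family of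
Galois orbits can do it).  The odd-slice transport (`CorCM/FaceCensusOddSlice{Dictionary,Transport,Closed}.lean`) turns this into
tree statements for ONE Galois CM field `K` with group `ℤ/2 × A`:

* §1 `exists_faceSet_oddSliceFamily` (dictionary datum on `GalT K`), `…_aut` (`Aut`-datum): there is a set `𝒮` of at most
  `#OrbitsA A` faces of `K` such that ONE period witness per face of `𝒮` on the universe of record implies the Hodge conjecture, in
  every codimension, for every complex abelian variety dominated by a finite product of abelian varieties realising CM types of CM
  fields embeddable in `K`;
* §3 the cyclotomic field `ℚ(ζ_p)`, `p = 2m + 1 ≥ 7` prime, `m` odd (`exists_faceSet_cyclotomic`): no datum at all beyond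
  `IsCyclotomicExtension {p} ℚ K` — at most `#OrbitsA (ℤ/m)` faces;
* §2 cyclic fields, from ONE generator (`exists_faceSet_oddSliceFamily_gen`, `finrank ℚ K = 2m`, `m ≥ 3` odd): at most
  `#OrbitsA (ℤ/m)` faces, `= (Σ_{a<m} (2^{gcd(m,a)} − 2)) / 2m` (b17's `card_orbitsA_zmod_mul`); instances BY NAME of b17's counts:
  degree `18` — at most `29` faces (`exists_faceSet_cyclic_eighteen`; `ℚ(ζ₁₉)`, `ℚ(ζ₂₇)`), degree `30` — at most `1095`
  (`exists_faceSet_cyclic_thirty`; `ℚ(ζ₃₁)`), degree `2p`, `p ≥ 3` prime — at most `(2^p − 2)/2p`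
  (`exists_faceSet_cyclic_prime`; `3, 9, 93, 315, …` for `2p = 10, 14, 22, 26`); and the non-cyclic abelian degree-`18` type
  `ℤ/2 × (ℤ/3)²` — at most `31` faces (`exists_faceSet_zmod_three_sq`, `Aut`-datum form).

No Cayley table, no bitmask, no certificate, no `decide` beyond b17's landed counts.  `HC_CM` is NOT proved; nothing here produces a
period.

References: [cite: Pohlmann1968, Thm. 1]; [cite: Milne1999LefschetzClasses, Thm. 3.2 and Cor. 4.5];
[cite: Shimura1998, §6.2 Theorem 3 and §6.1 Corollary of Theorem 2 (pp. 41–43)]; [cite: MumfordAV1970, §19 Thm. 1 and p. 169].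
-/

noncomputable section

open CategoryTheory NumberField NumberField.ComplexEmbedding
open Literature.AlgebraicGeometry Literature.AlgebraicGeometry.Motives Literature.AlgebraicGeometry.HodgeTheory
open Literature.AlgebraicGeometry.ComplexMultiplication Literature.AlgebraicGeometry.Milne1999
open Literature.NumberTheory.Automorphic
open Literature.NumberTheory.Automorphic.PicardCM
open Summit.HodgeConjecture.CorCM.Domination

namespace Summit.HodgeConjecture.CorCM

open Summit.HodgeConjecture.CorCM.Census.OddSliceFacesModel (Ty tw transl δ pairVec pairs hodge)
open Summit.HodgeConjecture.CorCM.Census.OddSliceFacesSquares (faceVec)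
open Summit.HodgeConjecture.CorCM.Census.OddSliceFacesGenerate (family family_places hodge_le_pairs_sup_spanFaces_family)
open Summit.HodgeConjecture.CorCM.Census.OddSliceFacesCount (family_card)
open Summit.HodgeConjecture.CorCM.Census.OddDegreeParityLaw (OrbitsA card_orbitsA_zmod_nine card_orbitsA_zmod_fifteen
  card_orbitsA_zmod_three_sq card_orbits_eq)
open Summit.HodgeConjecture.CorCM.FaceCensus.OddSlice

/-! ## §1 The faithful full odd slice through the transport -/

section Family

variable {A : Type} [AddCommGroup A] [Fintype A] [DecidableEq A]

/-- b09's generation theorem in the `span` form consumed by the transport (his `spanFaces` unfolded). [folklore] -/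
theorem hodge_le_pairs_sup_span_family (hA : Odd (Fintype.card A)) (h3 : 3 ≤ Fintype.card A) :
    hodge A ≤ pairs A ⊔
      Submodule.span ℤ {w : Ty A → ℤ | ∃ g : ZMod 2 × A, ∃ s ∈ family A, w = transl A g (faceVec A s.1 s.2.1 s.2.2)} :=
  hodge_le_pairs_sup_spanFaces_family A hA h3

/-- **THE FAITHFUL FULL ODD SLICE, TRANSPORTED (dictionary datum on `GalT K`).**  `K` a Galois CM field with
`θ : GalT K ≃ ℤ/2 × A` (multiplicative-to-additive, `conjT ↦ (1,0)`), `|A|` odd `≥ 3`, `σ₀` a base embedding: there is a finite set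
`𝒮` of at most `#OrbitsA A` rank-four faces of `K` — one reading each member of b09's `family A` — such that ONE period witness per
face of `𝒮` on the universe of record implies the Hodge conjecture, in every codimension, for every complex abelian variety
dominated by a finite product of abelian varieties realising CM types of CM fields embeddable in `K`.  (FRAMING: existence of the
face set + a conditional; `HC_CM` is not proved, no period is produced.)
[cite: Shimura1998, §6.2 Theorem 3 and §6.1 Corollary of Theorem 2 (pp. 41–43)] [cite: Pohlmann1968, Thm. 1]
[cite: Milne1999LefschetzClasses, Thm. 3.2 and Cor. 4.5] [cite: MumfordAV1970, §19 Thm. 1 and p. 169] -/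
theorem exists_faceSet_oddSliceFamily (K : CMField) [hGal : IsGalois ℚ K] (hA : Odd (Fintype.card A)) (h3 : 3 ≤ Fintype.card A)
    (θ : GalT K ≃ ZMod 2 × A) (hθ : ∀ P Q : GalT K, θ (P * Q) = θ P + θ Q) (hc : θ conjT = (1, 0))
    (σ₀ : (K : Type) →+* ℂ) :
    ∃ 𝒮 : Finset (Face K), 𝒮.card ≤ Fintype.card (OrbitsA A) ∧
      ((∀ f ∈ 𝒮, ∃ ι₁ : K →+* ℂ, f.Admissible ι₁ ∧ ∃ (V : HermSpace3 K ι₁) (σ : K →+* ℂ),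
        (Model.picardCMUniverse exists_isReal_hodgeModel_holds hodgePQ_independent_of_hodgeModel_holds
          BallQuotient.ballQuotientUniformised_holds cmAbelianVarietyRealised_holds).PeriodNV ι₁ V K f.psi σ) →
      ∀ {P B : AbelianVariety ℂ}, AbelianVariety.IsProductOf (fun B : AbelianVariety ℂ =>
        ∃ (E : Type) (_ : Field E) (_ : NumberField E) (_ : IsCMField E) (_ : E →+* (K : Type)) (Φ : CMType E)
          (ι : 𝓞 E →+* End B) (θ : E →+* Module.End ℂ (complexBetti B.X 1)),
          IsCMTypeRealisation Φ B ι θ) P →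
      AVDominatedBy B P → HodgeConjectureFor B.dim B.X) := by
  obtain ⟨𝒮, hcard, h⟩ := exists_faceSet_of_oddSlice K h3 θ hθ hc (family A) (fun s hs => family_places A h3 hs)
    (hodge_le_pairs_sup_span_family hA h3) σ₀
  exact ⟨𝒮, hcard.trans (family_card A h3).le, h⟩

/-- **THE FAITHFUL FULL ODD SLICE, TRANSPORTED (`Aut`-datum).**  Same conclusion from a bijection `ε : Aut(K) ≃ ℤ/2 × A`,
multiplicative-to-additive, carrying the automorphism inducing complex conjugation at `σ₀` to `(1, 0)`.
[cite: Shimura1998, §6.2 Theorem 3 and §6.1 Corollary of Theorem 2 (pp. 41–43)] [cite: Pohlmann1968, Thm. 1]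
[cite: Milne1999LefschetzClasses, Thm. 3.2 and Cor. 4.5] [cite: MumfordAV1970, §19 Thm. 1 and p. 169] -/
theorem exists_faceSet_oddSliceFamily_aut (K : CMField) [hGal : IsGalois ℚ K] (hA : Odd (Fintype.card A))
    (h3 : 3 ≤ Fintype.card A) (σ₀ : (K : Type) →+* ℂ) (ε : ((K : Type) ≃ₐ[ℚ] (K : Type)) ≃ ZMod 2 × A)
    (hε : ∀ x y : ((K : Type) ≃ₐ[ℚ] (K : Type)), ε (x * y) = ε x + ε y)
    {c : ((K : Type) ≃ₐ[ℚ] (K : Type))} (hcσ : σ₀.comp (c : (K : Type) →+* (K : Type)) = conjugate σ₀) (hεc : ε c = (1, 0)) :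
    ∃ 𝒮 : Finset (Face K), 𝒮.card ≤ Fintype.card (OrbitsA A) ∧
      ((∀ f ∈ 𝒮, ∃ ι₁ : K →+* ℂ, f.Admissible ι₁ ∧ ∃ (V : HermSpace3 K ι₁) (σ : K →+* ℂ),
        (Model.picardCMUniverse exists_isReal_hodgeModel_holds hodgePQ_independent_of_hodgeModel_holds
          BallQuotient.ballQuotientUniformised_holds cmAbelianVarietyRealised_holds).PeriodNV ι₁ V K f.psi σ) →
      ∀ {P B : AbelianVariety ℂ}, AbelianVariety.IsProductOf (fun B : AbelianVariety ℂ =>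
        ∃ (E : Type) (_ : Field E) (_ : NumberField E) (_ : IsCMField E) (_ : E →+* (K : Type)) (Φ : CMType E)
          (ι : 𝓞 E →+* End B) (θ : E →+* Module.End ℂ (complexBetti B.X 1)),
          IsCMTypeRealisation Φ B ι θ) P →
      AVDominatedBy B P → HodgeConjectureFor B.dim B.X) := by
  obtain ⟨hθ, hc⟩ := autDatum σ₀ ε hε hcσ hεc
  exact exists_faceSet_oddSliceFamily K hA h3 ((galTOfAut σ₀).symm.trans ε) hθ hc σ₀

/-- **The non-cyclic abelian type of degree 18, `ℤ/2 × (ℤ/3)²`: at most `31` faces** (b17's `card_orbitsA_zmod_three_sq`).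
[cite: Shimura1998, §6.2 Theorem 3 and §6.1 Corollary of Theorem 2 (pp. 41–43)] [cite: Pohlmann1968, Thm. 1]
[cite: Milne1999LefschetzClasses, Thm. 3.2 and Cor. 4.5] [cite: MumfordAV1970, §19 Thm. 1 and p. 169] -/
theorem exists_faceSet_zmod_three_sq (K : CMField) [hGal : IsGalois ℚ K] (σ₀ : (K : Type) →+* ℂ)
    (ε : ((K : Type) ≃ₐ[ℚ] (K : Type)) ≃ ZMod 2 × (ZMod 3 × ZMod 3))
    (hε : ∀ x y : ((K : Type) ≃ₐ[ℚ] (K : Type)), ε (x * y) = ε x + ε y)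
    {c : ((K : Type) ≃ₐ[ℚ] (K : Type))} (hcσ : σ₀.comp (c : (K : Type) →+* (K : Type)) = conjugate σ₀) (hεc : ε c = (1, 0)) :
    ∃ 𝒮 : Finset (Face K), 𝒮.card ≤ 31 ∧
      ((∀ f ∈ 𝒮, ∃ ι₁ : K →+* ℂ, f.Admissible ι₁ ∧ ∃ (V : HermSpace3 K ι₁) (σ : K →+* ℂ),
        (Model.picardCMUniverse exists_isReal_hodgeModel_holds hodgePQ_independent_of_hodgeModel_holds
          BallQuotient.ballQuotientUniformised_holds cmAbelianVarietyRealised_holds).PeriodNV ι₁ V K f.psi σ) →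
      ∀ {P B : AbelianVariety ℂ}, AbelianVariety.IsProductOf (fun B : AbelianVariety ℂ =>
        ∃ (E : Type) (_ : Field E) (_ : NumberField E) (_ : IsCMField E) (_ : E →+* (K : Type)) (Φ : CMType E)
          (ι : 𝓞 E →+* End B) (θ : E →+* Module.End ℂ (complexBetti B.X 1)),
          IsCMTypeRealisation Φ B ι θ) P →
      AVDominatedBy B P → HodgeConjectureFor B.dim B.X) := by
  have hA : Odd (Fintype.card (ZMod 3 × ZMod 3)) := by rw [Fintype.card_prod, ZMod.card]; decide
  have h3 : 3 ≤ Fintype.card (ZMod 3 × ZMod 3) := by rw [Fintype.card_prod, ZMod.card]; decide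
  obtain ⟨𝒮, hcard, h⟩ := exists_faceSet_oddSliceFamily_aut K hA h3 σ₀ ε hε hcσ hεc
  refine ⟨𝒮, hcard.trans ?_, h⟩
  rw [← Nat.card_eq_fintype_card, card_orbitsA_zmod_three_sq]

end Family

/-! ## §2 Cyclic CM fields of degree `2m`, `m` odd: from ONE generator -/

section Cyclic

/-- **THE FAITHFUL FULL ODD SLICE OF A CYCLIC CM FIELD, TRANSPORTED.**  `K` a Galois CM field with `finrank ℚ K = 2m`, `m ≥ 3`
odd, whose automorphism group is generated by `g`; `σ₀` any base embedding (complex conjugation is `g^m` automatically).  Then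
there is a finite set `𝒮` of at most `#OrbitsA (ℤ/m)` rank-four faces of `K` such that ONE period witness per face of `𝒮` on the
universe of record implies the Hodge conjecture, in every codimension, for every complex abelian variety dominated by a finite
product of abelian varieties realising CM types of CM fields embeddable in `K`.  (FRAMING: existence of the face set + a
conditional; `HC_CM` is not proved, no period is produced.)
[cite: Shimura1998, §6.2 Theorem 3 and §6.1 Corollary of Theorem 2 (pp. 41–43)] [cite: Pohlmann1968, Thm. 1]
[cite: Milne1999LefschetzClasses, Thm. 3.2 and Cor. 4.5] [cite: MumfordAV1970, §19 Thm. 1 and p. 169] -/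
theorem exists_faceSet_oddSliceFamily_gen (K : CMField) [hGal : IsGalois ℚ K] {m : ℕ} [NeZero m] (hm : Odd m) (h3 : 3 ≤ m)
    (hK : Module.finrank ℚ (K : Type) = 2 * m) {g : ((K : Type) ≃ₐ[ℚ] (K : Type))} (hg : ∀ x, x ∈ Subgroup.zpowers g)
    (σ₀ : (K : Type) →+* ℂ) :
    ∃ 𝒮 : Finset (Face K), 𝒮.card ≤ Fintype.card (OrbitsA (ZMod m)) ∧
      ((∀ f ∈ 𝒮, ∃ ι₁ : K →+* ℂ, f.Admissible ι₁ ∧ ∃ (V : HermSpace3 K ι₁) (σ : K →+* ℂ),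
        (Model.picardCMUniverse exists_isReal_hodgeModel_holds hodgePQ_independent_of_hodgeModel_holds
          BallQuotient.ballQuotientUniformised_holds cmAbelianVarietyRealised_holds).PeriodNV ι₁ V K f.psi σ) →
      ∀ {P B : AbelianVariety ℂ}, AbelianVariety.IsProductOf (fun B : AbelianVariety ℂ =>
        ∃ (E : Type) (_ : Field E) (_ : NumberField E) (_ : IsCMField E) (_ : E →+* (K : Type)) (Φ : CMType E)
          (ι : 𝓞 E →+* End B) (θ : E →+* Module.End ℂ (complexBetti B.X 1)),
          IsCMTypeRealisation Φ B ι θ) P →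
      AVDominatedBy B P → HodgeConjectureFor B.dim B.X) := by
  obtain ⟨ε, hε, -, hconj⟩ := exists_autDatum_of_generator K hm hK hg σ₀
  obtain ⟨c, hcσ⟩ := FaceCensus.exists_conjAut σ₀
  have hA : Odd (Fintype.card (ZMod m)) := by rwa [ZMod.card]
  have h3' : 3 ≤ Fintype.card (ZMod m) := by rwa [ZMod.card]
  exact exists_faceSet_oddSliceFamily_aut K hA h3' σ₀ ε hε hcσ (hconj c hcσ)

/-- **Cyclic CM fields of degree `18` (`ℚ(ζ₁₉)`, `ℚ(ζ₂₇)`, …): at most `29` faces** (b17's `card_orbitsA_zmod_nine`; b23's census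
`CYCLIC-MU.md`: `μ(ℤ/18) = 29` is attained).
[cite: Shimura1998, §6.2 Theorem 3 and §6.1 Corollary of Theorem 2 (pp. 41–43)] [cite: Pohlmann1968, Thm. 1]
[cite: Milne1999LefschetzClasses, Thm. 3.2 and Cor. 4.5] [cite: MumfordAV1970, §19 Thm. 1 and p. 169] -/
theorem exists_faceSet_cyclic_eighteen (K : CMField) [hGal : IsGalois ℚ K] (hK : Module.finrank ℚ (K : Type) = 18)
    {g : ((K : Type) ≃ₐ[ℚ] (K : Type))} (hg : ∀ x, x ∈ Subgroup.zpowers g) (σ₀ : (K : Type) →+* ℂ) :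
    ∃ 𝒮 : Finset (Face K), 𝒮.card ≤ 29 ∧
      ((∀ f ∈ 𝒮, ∃ ι₁ : K →+* ℂ, f.Admissible ι₁ ∧ ∃ (V : HermSpace3 K ι₁) (σ : K →+* ℂ),
        (Model.picardCMUniverse exists_isReal_hodgeModel_holds hodgePQ_independent_of_hodgeModel_holds
          BallQuotient.ballQuotientUniformised_holds cmAbelianVarietyRealised_holds).PeriodNV ι₁ V K f.psi σ) →
      ∀ {P B : AbelianVariety ℂ}, AbelianVariety.IsProductOf (fun B : AbelianVariety ℂ =>
        ∃ (E : Type) (_ : Field E) (_ : NumberField E) (_ : IsCMField E) (_ : E →+* (K : Type)) (Φ : CMType E)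
          (ι : 𝓞 E →+* End B) (θ : E →+* Module.End ℂ (complexBetti B.X 1)),
          IsCMTypeRealisation Φ B ι θ) P →
      AVDominatedBy B P → HodgeConjectureFor B.dim B.X) := by
  obtain ⟨𝒮, hcard, h⟩ := exists_faceSet_oddSliceFamily_gen K (m := 9) (by decide) (by decide) hK hg σ₀
  refine ⟨𝒮, hcard.trans ?_, h⟩
  rw [← Nat.card_eq_fintype_card, card_orbitsA_zmod_nine]

/-- **Cyclic CM fields of degree `30` (`ℚ(ζ₃₁)`, …): at most `1095` faces** (b17's `card_orbitsA_zmod_fifteen`).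
[cite: Shimura1998, §6.2 Theorem 3 and §6.1 Corollary of Theorem 2 (pp. 41–43)] [cite: Pohlmann1968, Thm. 1]
[cite: Milne1999LefschetzClasses, Thm. 3.2 and Cor. 4.5] [cite: MumfordAV1970, §19 Thm. 1 and p. 169] -/
theorem exists_faceSet_cyclic_thirty (K : CMField) [hGal : IsGalois ℚ K] (hK : Module.finrank ℚ (K : Type) = 30)
    {g : ((K : Type) ≃ₐ[ℚ] (K : Type))} (hg : ∀ x, x ∈ Subgroup.zpowers g) (σ₀ : (K : Type) →+* ℂ) :
    ∃ 𝒮 : Finset (Face K), 𝒮.card ≤ 1095 ∧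
      ((∀ f ∈ 𝒮, ∃ ι₁ : K →+* ℂ, f.Admissible ι₁ ∧ ∃ (V : HermSpace3 K ι₁) (σ : K →+* ℂ),
        (Model.picardCMUniverse exists_isReal_hodgeModel_holds hodgePQ_independent_of_hodgeModel_holds
          BallQuotient.ballQuotientUniformised_holds cmAbelianVarietyRealised_holds).PeriodNV ι₁ V K f.psi σ) →
      ∀ {P B : AbelianVariety ℂ}, AbelianVariety.IsProductOf (fun B : AbelianVariety ℂ =>
        ∃ (E : Type) (_ : Field E) (_ : NumberField E) (_ : IsCMField E) (_ : E →+* (K : Type)) (Φ : CMType E)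
          (ι : 𝓞 E →+* End B) (θ : E →+* Module.End ℂ (complexBetti B.X 1)),
          IsCMTypeRealisation Φ B ι θ) P →
      AVDominatedBy B P → HodgeConjectureFor B.dim B.X) := by
  obtain ⟨𝒮, hcard, h⟩ := exists_faceSet_oddSliceFamily_gen K (m := 15) (by decide) (by decide) hK hg σ₀
  refine ⟨𝒮, hcard.trans ?_, h⟩
  rw [← Nat.card_eq_fintype_card, card_orbitsA_zmod_fifteen]

/-- **Cyclic CM fields of degree `2p`, `p ≥ 3` prime (`ℚ(ζ_q)` for `q ≡ 3 (mod 4)` prime with `(q−1)/2` prime, the degree-`2p`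
CM subfields of cyclotomic fields, …): at most `(2^p − 2)/2p` faces** — `3, 9, 93, 315` for `2p = 10, 14, 22, 26` (b17's
`card_orbits_eq`).
[cite: Shimura1998, §6.2 Theorem 3 and §6.1 Corollary of Theorem 2 (pp. 41–43)] [cite: Pohlmann1968, Thm. 1]
[cite: Milne1999LefschetzClasses, Thm. 3.2 and Cor. 4.5] [cite: MumfordAV1970, §19 Thm. 1 and p. 169] -/
theorem exists_faceSet_cyclic_prime (K : CMField) [hGal : IsGalois ℚ K] {p : ℕ} [hp : Fact p.Prime] (hp3 : 3 ≤ p)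
    (hK : Module.finrank ℚ (K : Type) = 2 * p) {g : ((K : Type) ≃ₐ[ℚ] (K : Type))} (hg : ∀ x, x ∈ Subgroup.zpowers g)
    (σ₀ : (K : Type) →+* ℂ) :
    ∃ 𝒮 : Finset (Face K), 𝒮.card ≤ (2 ^ p - 2) / (2 * p) ∧
      ((∀ f ∈ 𝒮, ∃ ι₁ : K →+* ℂ, f.Admissible ι₁ ∧ ∃ (V : HermSpace3 K ι₁) (σ : K →+* ℂ),
        (Model.picardCMUniverse exists_isReal_hodgeModel_holds hodgePQ_independent_of_hodgeModel_holds
          BallQuotient.ballQuotientUniformised_holds cmAbelianVarietyRealised_holds).PeriodNV ι₁ V K f.psi σ) →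
      ∀ {P B : AbelianVariety ℂ}, AbelianVariety.IsProductOf (fun B : AbelianVariety ℂ =>
        ∃ (E : Type) (_ : Field E) (_ : NumberField E) (_ : IsCMField E) (_ : E →+* (K : Type)) (Φ : CMType E)
          (ι : 𝓞 E →+* End B) (θ : E →+* Module.End ℂ (complexBetti B.X 1)),
          IsCMTypeRealisation Φ B ι θ) P →
      AVDominatedBy B P → HodgeConjectureFor B.dim B.X) := by
  have hp2 : p ≠ 2 := by omega
  have hm : Odd p := hp.out.odd_of_ne_two hp2
  obtain ⟨𝒮, hcard, h⟩ := exists_faceSet_oddSliceFamily_gen K hm hp3 hK hg σ₀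
  refine ⟨𝒮, hcard.trans ?_, h⟩
  rw [← Nat.card_eq_fintype_card]
  exact (card_orbits_eq p hp2).le

end Cyclic

/-! ## §3 The cyclotomic fields `ℚ(ζ_p)`, `p ≡ 3 (mod 4)` -/

section Cyclotomic

/-- **THE CYCLOTOMIC FIELD `ℚ(ζ_p)`, `p = 2m + 1 ≥ 7` prime with `m` odd (`p ≡ 3 (mod 4)`: `p = 7, 11, 19, 23, 31, 43, 47, 59, …`).**
`K` any CM field that is a `p`-th cyclotomic extension of `ℚ` (the field seat supplies `⟨CyclotomicField p ℚ⟩` with Mathlib's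
`IsCyclotomicExtension.Rat.isCMField`); `σ₀` any complex embedding.  Then — Galois group cyclic of order `p − 1 = 2m` by
`IsCyclotomicExtension.autEquivPow`, so NO further datum is needed — there is a finite set `𝒮` of at most `#OrbitsA (ℤ/m)` rank-four
faces of `K` (`= 1, 3, 29, 93, 1095` for `p = 7, 11, 19, 23, 31`) such that ONE period witness per face of `𝒮` on the universe of record
implies the Hodge conjecture, in every codimension, for every complex abelian variety dominated by a finite product of abelian
varieties realising CM types of CM fields embeddable in `ℚ(ζ_p)` (all Fermat-type CM abelian varieties of level `p` among them).
(FRAMING: existence of the face set + a conditional; `HC_CM` is not proved, no period is produced.)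
[cite: Shimura1998, §6.2 Theorem 3 and §6.1 Corollary of Theorem 2 (pp. 41–43)] [cite: Pohlmann1968, Thm. 1]
[cite: Milne1999LefschetzClasses, Thm. 3.2 and Cor. 4.5] [cite: MumfordAV1970, §19 Thm. 1 and p. 169] -/
theorem exists_faceSet_cyclotomic (K : CMField) {p m : ℕ} [hp : Fact p.Prime] [NeZero m] (hm : Odd m) (h3 : 3 ≤ m)
    (hpm : p = 2 * m + 1) [IsCyclotomicExtension {p} ℚ (K : Type)] (σ₀ : (K : Type) →+* ℂ) :
    ∃ 𝒮 : Finset (Face K), 𝒮.card ≤ Fintype.card (OrbitsA (ZMod m)) ∧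
      ((∀ f ∈ 𝒮, ∃ ι₁ : K →+* ℂ, f.Admissible ι₁ ∧ ∃ (V : HermSpace3 K ι₁) (σ : K →+* ℂ),
        (Model.picardCMUniverse exists_isReal_hodgeModel_holds hodgePQ_independent_of_hodgeModel_holds
          BallQuotient.ballQuotientUniformised_holds cmAbelianVarietyRealised_holds).PeriodNV ι₁ V K f.psi σ) →
      ∀ {P B : AbelianVariety ℂ}, AbelianVariety.IsProductOf (fun B : AbelianVariety ℂ =>
        ∃ (E : Type) (_ : Field E) (_ : NumberField E) (_ : IsCMField E) (_ : E →+* (K : Type)) (Φ : CMType E)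
          (ι : 𝓞 E →+* End B) (θ : E →+* Module.End ℂ (complexBetti B.X 1)),
          IsCMTypeRealisation Φ B ι θ) P →
      AVDominatedBy B P → HodgeConjectureFor B.dim B.X) := by
  haveI : IsGalois ℚ (K : Type) := IsCyclotomicExtension.isGalois {p} ℚ (K : Type)
  have hirr : Irreducible (Polynomial.cyclotomic p ℚ) := Polynomial.cyclotomic.irreducible_rat hp.out.pos
  have hK : Module.finrank ℚ (K : Type) = 2 * m := by
    rw [IsCyclotomicExtension.finrank (K : Type) hirr, Nat.totient_prime hp.out, hpm]
    omega
  haveI : IsCyclic ((K : Type) ≃ₐ[ℚ] (K : Type)) :=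
    isCyclic_of_surjective (IsCyclotomicExtension.autEquivPow (K : Type) hirr).symm.toMonoidHom
      (IsCyclotomicExtension.autEquivPow (K : Type) hirr).symm.surjective
  obtain ⟨g, hg⟩ := IsCyclic.exists_generator (α := ((K : Type) ≃ₐ[ℚ] (K : Type)))
  exact exists_faceSet_oddSliceFamily_gen K hm h3 hK hg σ₀

end Cyclotomic

end Summit.HodgeConjecture.CorCM

end
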